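import Mathlib
import Summits.Ventures.HodgeRepro2.T5CayleySU11

/-!
# T5TorusCharacters — orthogonality of the weights of `SO(2)` in coordinates

Tier-5 support (seat p1, cell pub-hodge-repro2), the Schur orthogonality relations for the
compact group `SO(2) = {k(θ)}` (the `K_W ∩ SU(1,1)` of N4.3 (P2′), `T5CayleySU11.rotation θ`, whose
characters are the weights `θ ↦ e^{ikθ}`, `k ∈ ℤ` — `T5CayleySU11.torus_character_rotation`) written
out in the coordinate `θ ∈ [0, 2π]`:

  `∫₀^{2π} e^{imθ} · conj(e^{inθ}) dθ = 2π · [m = n]`   (`integral_exp_mul_conj_exp`),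

i.e. the weights are orthogonal and of norm `2π` = the volume of `SO(2)` in this coordinate
(`integral_exp_mul_conj_exp_div`: the normalised relation with `(2π)⁻¹ ∫`). This is the
one-dimensional case of `T5SchurOrthogonality.schur_orthogonality` for the abelian group
`SO(2)`, made explicit by Mathlib's `integral_exp_mul_complex` and `Complex.exp_int_mul_two_pi_mul_I`;
it is what makes the sentence «the SO(2)-weights … each once» of (P2′) a statement about orthogonal
lines. The product of the two characters is `T5CayleySU11.torus_character_rotation_neg`.

Honest scope: nothing about the discrete series itself (the K-types {3, 5, 7, …} as
REPRESENTATIONS stay [C]); nothing about (N).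
-/

noncomputable section

open Complex ComplexConjugate
open scoped Real

namespace Summit.Ventures.HodgeRepro2.T5TorusCharacters

/-- The conjugate of the weight `e^{inθ}` is `e^{-inθ}` (real `θ`). -/
theorem conj_exp_int_mul (n : ℤ) (θ : ℝ) :
    conj (Complex.exp (n * (θ * I))) = Complex.exp (-(n : ℂ) * (θ * I)) := by
  rw [← Complex.exp_conj]
  congr 1
  simp [Complex.conj_ofReal]

/-- The product of two weights is the weight of the difference. -/
theorem exp_mul_conj_exp (m n : ℤ) (θ : ℝ) :
    Complex.exp (m * (θ * I)) * conj (Complex.exp (n * (θ * I))) =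
      Complex.exp (((m - n : ℤ) : ℂ) * (θ * I)) := by
  rw [conj_exp_int_mul, ← Complex.exp_add]
  congr 1
  push_cast
  ring

/-- `∫₀^{2π} e^{ikθ} dθ = 2π · [k = 0]`. -/
theorem integral_exp_int_mul (k : ℤ) :
    ∫ θ in (0 : ℝ)..(2 * π), Complex.exp ((k : ℂ) * (θ * I)) = if k = 0 then 2 * π else 0 := by
  split_ifs with hk
  · subst hk
    simp
  · have hc : ((k : ℂ) * I) ≠ 0 := mul_ne_zero (by exact_mod_cast hk) I_ne_zero
    have h1 : ∀ θ : ℝ, Complex.exp ((k : ℂ) * (θ * I)) = Complex.exp (((k : ℂ) * I) * θ) := by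
      intro θ; congr 1; ring
    simp_rw [h1]
    rw [integral_exp_mul_complex hc]
    have h2 : Complex.exp (((k : ℂ) * I) * ((2 * π : ℝ) : ℂ)) = 1 := by
      rw [← Complex.exp_int_mul_two_pi_mul_I k]
      congr 1
      push_cast
      ring
    rw [h2]
    simp

/-- **Orthogonality of the weights of `SO(2)`**:
`∫₀^{2π} e^{imθ} · conj(e^{inθ}) dθ = 2π · [m = n]`. -/
theorem integral_exp_mul_conj_exp (m n : ℤ) :
    ∫ θ in (0 : ℝ)..(2 * π), Complex.exp (m * (θ * I)) * conj (Complex.exp (n * (θ * I))) =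
      if m = n then 2 * π else 0 := by
  simp_rw [exp_mul_conj_exp]
  rw [integral_exp_int_mul]
  simp [sub_eq_zero]

/-- The normalised relation: `(2π)⁻¹ ∫₀^{2π} e^{imθ} · conj(e^{inθ}) dθ = [m = n]` — the Schur
relation for the one-dimensional representations of the compact abelian group `SO(2)`. -/
theorem integral_exp_mul_conj_exp_div (m n : ℤ) :
    (2 * π : ℂ)⁻¹ * ∫ θ in (0 : ℝ)..(2 * π),
      Complex.exp (m * (θ * I)) * conj (Complex.exp (n * (θ * I))) = if m = n then 1 else 0 := by
  rw [integral_exp_mul_conj_exp]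
  have hπ : (2 * π : ℂ) ≠ 0 := by
    have : (π : ℂ) ≠ 0 := by exact_mod_cast Real.pi_ne_zero
    exact mul_ne_zero two_ne_zero this
  split_ifs
  · push_cast
    exact inv_mul_cancel₀ hπ
  · simp

/-- In the coordinates of `T5CayleySU11` (the torus `diag(e^{-iθ}, e^{iθ})` of
`cayleyConj_rotation`): the integral of the product of the two torus characters of weights
`m`, `n` over a period is `2π · [m = n]`. -/
theorem integral_torus_character (m n : ℤ) :
    ∫ θ in (0 : ℝ)..(2 * π),
      Complex.exp ((θ : ℂ) * I) ^ m * Complex.exp (-(θ : ℂ) * I) ^ n =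
      if m = n then 2 * π else 0 := by
  simp_rw [Summit.Ventures.HodgeRepro2.T5CayleySU11.torus_character_rotation_neg]
  rw [integral_exp_int_mul]
  simp [sub_eq_zero]

end Summit.Ventures.HodgeRepro2.T5TorusCharacters
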